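import Summits.QuantumFields.YangMills.Theorems.BalabanUVNodesN15KingModelThm33AtRegularFieldRegionDatumAlong
import Literature.MathematicalPhysics.QuantumFieldTheory.Balaban1983to89.B3Ineq210RegularBox
import Literature.MathematicalPhysics.QuantumFieldTheory.Balaban1983to89.B1Ineq224RegularBox

/-!
# Route «BalabanUVNodes», node N15 = NE2 — THE KING-MODEL RUNG, PART Θ⁺⁺⁺-a: KING 1986 THEOREM 3.3 ON A BIG-BLOCK **BOX** (King's «rectangular
# parallelepiped which is a union of large blocks») AT A REGULAR BACKGROUND — THE FINE-LATTICE CLAUSES (3.7), (3.8) **WITHOUT THE `R₀`-RESTRICTION**,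
# BY NAME from the tree's [Ba1] Prop. 2.1 «for rectangular parallelepipeds, the inequalities hold without any restrictions on the points x, x′»

Cell `pub-ymgap`, Track A (D-0062), seat `pub-ymgap-dag-n15-e` (R141 (C), s3), generation 21; sequel of PART Θ⁺⁺ (`…RegionDatum∕Unit∕Fine∕Region`).
`bears_on: R4∕N15`; `--supports stmt-QuantumFields-27366` (K3⁸, `--as helper`).  COUNT-NEUTRAL.  Namespace `…N15KingModelRung.Curved`.

THE PRINT.  [King1986] Thm 3.3 p. 655: *«let Ω^{(k)} be a rectangular parallelepiped which is a union of large blocks on T₁^{(k)}»*; [Balaban1982Higgs1]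
p. 611 l.1–2: *«For some simple sets Ω, e.g. for rectangular parallelepipeds, the inequalities hold without any restrictions on the points x, x′, i.e.
for all x, x′ ∈ Ω.»* (= [Balaban1983RegularityDecay] p. 579 «if Ω is a rectangular parallelepiped … the restriction dist({x, x′}, Ωᶜ) ≧ R₀ is
unnecessary»).

WHAT THIS FILE PROVES (0 `sorry`; one dictionary `def`).
* `bset Ω` — the sites of `Ω` all of whose forward bonds `⟨x, x + e_μ⟩` lie in `Ω` (where King's forward covariant derivatives `D^η_{A,μ}` of a
  function on `Ω_η` live; the tree's box theorems are stated for bonds of `Ω`), `mem_bset`.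
* ★★ **`box_fine_clauses`**: for `d ≥ 1`, `L` odd `> 1`, `a, m² > 0`, `N`, `(e, q)` there are `K₀min` and, for every cube size `K₀ ≥ K₀min`, a
  threshold `t > 0` such that for every torus of the carrier with `K₀ ∣ M`, `3K₀ ≤ 2M`, every level `1 ≤ k < K_P` with `L^kε ≤ 1`, EVERY CELL-PRODUCT
  BOX `Ω = cellBox k K₀ S` (p35's `B1Ineq225RegularBox.cellBox`), every fine carrier `V`, every field `A` with one-step differences `≤ δ`,
  `L^k·δ·|e| ≤ t`, there are `C₁, δ₁ > 0` such that for all `C ≥ C₁`, `0 < δ₀ ≤ δ₁` the datum `D = kingThm33DataAlong C P k Ω V Γ A a m²` (any admissible contour system `Γ`) satisfies,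
  POINTWISE AND WITHOUT ANY INTERIOR CONDITION: (3.7) for `D.G` at every point of `V`; (3.7) for `D.DG μ` at every point of `V` in `bset Ω`; (3.8)
  (`α = ½`) at every pair `x ≠ y` of points of `V` in `bset Ω` whose contour `Γ y x` stays in `Ω`.  SOURCES, BY NAME (no `R₀`):
  p26 `B3Ineq210RegularBox.norm_propagatorK_box_reg_decay_sum` ((2.25) value, every point), `norm_covDeriv_propagatorK_box_reg_decay_sum`
  ((2.25) derivative, every bond of `Ω`), p35 `B1Ineq224RegularBox.norm_holder_propagatorK_box_reg_decay_sum` ((2.24), every pair of bonds of `Ω`,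
  chain inside `Ω`), fed at `c_reg = 1`, `β = 1`, `ε₀ = 1`, rate `1∕(4K₀)` per `L^k` fine steps.  [cite: King1986, Thm 3.3 (3.7)–(3.8) p.656]
  [cite: Balaban1982Higgs1, Prop. 2.1 (2.24)–(2.25) p.610, p.611 l.1–2] [cite: Balaban1983RegularityDecay, Theorem (1.9)–(1.11) p.573, p.579]

HONEST FRAMING ∕ SCOPE.  A KNIT; no estimate is new.  «Rectangular parallelepiped» ↦ p35's cell-product box `cellBox k K₀ S` (arbitrary index sets
`S_μ`, also wrapping the torus); the Hölder clause is stated for pairs whose transport contour `Γ y x` lies in `Ω` (the contour system `Γ` is a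
parameter of the datum, PART Θ⁺⁺-a′; for a product of cell intervals at most half the torus the coordinatewise shortest staircase qualifies —
PART Θ⁺⁺⁺-d `…IntervalBox`; the assembly PART Θ⁺⁺⁺-c carries `Γ ⊂ Ω` as an explicit hypothesis).  Tori with `K₀ ∣ M`, `3K₀ ≤ 2M`, `m² > 0`, `1 ≤ k < K_P`, `L^kε ≤ 1`, constants per `K₀`.
NOT Bałaban's non-abelian `G(U)`; NE2⁺ NOT printed ∕ not proved; NOT a node discharge; counts untouched; nothing continuum ∕ ℝ⁴ ∕ OS ∕ mass-gap ∕ Clay.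
-/

noncomputable section

open scoped BigOperators

namespace Summit.QuantumFields.YangMills.BalabanUVNodes.N15KingModelRung.Curved

open Literature.MathematicalPhysics.QuantumFieldTheory.Balaban1983to89
open Literature.MathematicalPhysics.QuantumFieldTheory.Balaban1983to89.HiggsLattice (ChargeData covDeriv)
open Literature.MathematicalPhysics.QuantumFieldTheory.Balaban1983to89.HiggsCovariance (propagatorK)
open Literature.MathematicalPhysics.QuantumFieldTheory.Balaban1983to89.B1Eq230FluctCov (Ix)
open Literature.MathematicalPhysics.QuantumFieldTheory.Balaban1983to89.B1TorusChainTransport (hol)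
open Literature.MathematicalPhysics.QuantumFieldTheory.Balaban1983to89.B3Ineq211RegularTorus (IsAdm one_le_tdist_of_ne')
open Literature.MathematicalPhysics.QuantumFieldTheory.Balaban1983to89.B1TorusCubeCover (half)
open Literature.MathematicalPhysics.QuantumFieldTheory.Balaban1983to89.B1TorusRegionRop (chi)
open Literature.MathematicalPhysics.QuantumFieldTheory.Balaban1983to89.B1Ineq225BackgroundTorus (three_half_le_sites)
open Literature.MathematicalPhysics.QuantumFieldTheory.Balaban1983to89.B1Ineq225RegularBox (cellBox)
open Literature.MathematicalPhysics.QuantumFieldTheory.Balaban1983to89.B3Ineq210RegularBox (norm_propagatorK_box_reg_decay_sum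
  norm_covDeriv_propagatorK_box_reg_decay_sum)
open Literature.MathematicalPhysics.QuantumFieldTheory.Balaban1983to89.B1Ineq224RegularBox (norm_holder_propagatorK_box_reg_decay_sum)
open Literature.MathematicalPhysics.QuantumFieldTheory.King1986.ContinuumLimit (Thm33Data Thm33Printed)

variable {N : ℕ}

section BSet

variable {P : HiggsLattice.Params}

/-- THE BOND-CLOSED SITES OF `Ω`: the sites `x ∈ Ω` with `x + e_μ ∈ Ω` for every `μ` (where the forward covariant derivatives of a function on `Ω_η` are
bonds of `Ω`). [cite: King1986, Thm 3.3 (3.7) p.656 «D^η_{A,μ}G_k(Ω, A)f(x)»] [cite: Balaban1982Higgs1, Prop. 2.1 p.611 l.1–2] -/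
def bset (Ω : Finset (HiggsLattice.Site P 0)) : Finset (HiggsLattice.Site P 0) := Ω.filter fun x => ∀ μ, x.shift μ ∈ Ω

/-- membership in `bset`. [cite: Balaban1982Higgs1, Prop. 2.1 p.611] -/
theorem mem_bset {Ω : Finset (HiggsLattice.Site P 0)} {x : HiggsLattice.Site P 0} : x ∈ bset Ω ↔ x ∈ Ω ∧ ∀ μ, x.shift μ ∈ Ω := by
  unfold bset; rw [Finset.mem_filter]

end BSet

set_option maxHeartbeats 400000 in
/-- ★★ **THE FINE-LATTICE CLAUSES (3.7), (3.8) OF KING 1986 THEOREM 3.3 ON A BIG-BLOCK BOX AT A REGULAR BACKGROUND, WITHOUT THE `R₀`-RESTRICTION**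
(pointwise, every fine carrier `V`; statement and sources in the module docstring). [cite: King1986, Thm 3.3 (3.7)–(3.8) p.656]
[cite: Balaban1982Higgs1, Prop. 2.1 (2.24)–(2.25) p.610, p.611 l.1–2] [cite: Balaban1983RegularityDecay, Theorem (1.9)–(1.11) p.573, p.579] -/
theorem box_fine_clauses (d L : ℕ) (hd : 1 ≤ d) (hL : Odd L ∧ 1 < L) {a msq : ℝ} (ha : 0 < a) (hmsq : 0 < msq) (N : ℕ) (C : ChargeData N) :
    ∃ K₀min : ℕ, ∀ K₀ : ℕ, K₀min ≤ K₀ → ∃ t : ℝ, 0 < t ∧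
      ∀ (P : HiggsLattice.Params), P.d = d → P.L = L → K₀ ∣ P.M → 3 * K₀ ≤ 2 * P.M →
      ∀ {k : ℕ}, 1 ≤ k → k < P.K → P.mesh k ≤ 1 →
      ∀ (S : Fin P.d → Finset ℕ) (V : Finset (HiggsLattice.Site P 0)),
      ∀ (Γ : HiggsLattice.Site P 0 → HiggsLattice.Site P 0 → List (HiggsLattice.Site P 0)), (∀ y x, IsAdm y x (Γ y x)) →
      ∀ (A : HiggsLattice.VecField P 0) {δ : ℝ}, 0 ≤ δ →
        (∀ (z : HiggsLattice.Site P 0) (μ ν : Fin P.d), |A ⟨z.shift ν, μ⟩ - A ⟨z, μ⟩| ≤ δ) →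
        (P.L : ℝ) ^ k * δ * |C.e| ≤ t →
        ∃ C₁ δ₁ : ℝ, 0 < C₁ ∧ 0 < δ₁ ∧ ∀ (Cc δ₀ : ℝ), C₁ ≤ Cc → 0 < δ₀ → δ₀ ≤ δ₁ →
        ∀ D : Thm33Data P.d (USite k (cellBox k K₀ S)) (VSite V) (EuclideanSpace ℝ (Fin N)), D = kingThm33DataAlong C P k (cellBox k K₀ S) V Γ A a msq →
          (∀ f x, ‖D.G f x‖ ≤ Cc * Real.exp (-(δ₀ * D.dsupp f x)) * D.supNorm f) ∧
          (∀ μ f x, x.1 ∈ bset (cellBox k K₀ S) → ‖D.DG μ f x‖ ≤ Cc * Real.exp (-(δ₀ * D.dsupp f x)) * D.supNorm f) ∧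
          (∀ μ f x y, x ≠ y → x.1 ∈ bset (cellBox k K₀ S) → y.1 ∈ bset (cellBox k K₀ S) → (∀ z ∈ Γ y.1 x.1, z ∈ cellBox k K₀ S) →
            (D.distη x y) ^ (-(1 / 2 : ℝ)) * ‖D.transport y x (D.DG μ f x) - D.DG μ f y‖
              ≤ Cc * Real.exp (-(δ₀ * D.dsupp2 f x y)) * D.supNorm f) := by
  have hL2 : 2 ≤ L := hL.2
  obtain ⟨K₁, hV⟩ := norm_propagatorK_box_reg_decay_sum d L hd hL2 ha hmsq N C 1 1 1 zero_le_one one_pos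
  obtain ⟨K₂, hD⟩ := norm_covDeriv_propagatorK_box_reg_decay_sum d L hd hL2 ha hmsq N C 1 1 1 zero_le_one one_pos
  obtain ⟨K₃, hH0⟩ := norm_holder_propagatorK_box_reg_decay_sum d L hd hL2 ha hmsq N C 1 1 1 zero_le_one one_pos
  refine ⟨max (max K₁ K₂) (max K₃ 1), fun K₀ hK₀ => ?_⟩
  obtain ⟨⟨hK₁, hK₂⟩, hK₃, hK₀1⟩ : (K₁ ≤ K₀ ∧ K₂ ≤ K₀) ∧ K₃ ≤ K₀ ∧ 1 ≤ K₀ := by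
    simp only [max_le_iff] at hK₀; exact hK₀
  obtain ⟨cV, eV, hcV, heV, hV'⟩ := hV K₀ hK₁
  obtain ⟨cD, eD, hcD, heD, hD'⟩ := hD K₀ hK₂
  obtain ⟨cH, eH, hcH, heH, hH'⟩ := hH0 (α := 1 / 2) (by norm_num) (by norm_num) K₀ hK₃
  clear hV hD hH0
  have hK₀r : (0 : ℝ) < K₀ := by exact_mod_cast hK₀1
  -- the threshold
  obtain ⟨t, htdef⟩ : ∃ t : ℝ, t = min eV (min eD eH) := ⟨_, rfl⟩
  have htpos : 0 < t := by rw [htdef]; exact lt_min heV (lt_min heD heH)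
  refine ⟨t, htpos, ?_⟩
  intro P hPd hPL hK₀M h3M k hk1 hkK hs S V Γ hΓ A δ hδ hreg ht
  obtain ⟨j, rfl⟩ : ∃ j, k = j + 1 := ⟨k - 1, by omega⟩
  have ht' : ∀ u, t ≤ u → (P.L : ℝ) ^ (j + 1) * δ * |C.e| ≤ u := fun u hu => ht.trans hu
  have htV := ht' eV (by rw [htdef]; exact min_le_left _ _)
  have htD := ht' eD (by rw [htdef]; exact (min_le_right _ _).trans (min_le_left _ _))
  have htH := ht' eH (by rw [htdef]; exact (min_le_right _ _).trans (min_le_right _ _))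
  have hLpos : (0 : ℝ) < (P.L : ℝ) := by exact_mod_cast P.hL
  have hLk : (0 : ℝ) < (P.L : ℝ) ^ (j + 1) := pow_pos hLpos _
  have hmesh : 0 < P.mesh (j + 1) := P.mesh_pos _
  have hN3 : ∀ μ, 3 * half P (j + 1) K₀ ≤ P.sitesPerDir 0 μ := fun μ => three_half_le_sites hkK.le h3M μ
  -- the regularity currency at `c = 1`, `β = 1`, `e_k := e₁`, on the box
  have hreg35 : ∀ {e₁ : ℝ}, 0 < e₁ → (P.L : ℝ) ^ (j + 1) * δ * |C.e| ≤ e₁ →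
      ∀ z ∈ cellBox (j + 1) K₀ S, ∀ (μ ν : Fin P.d),
        P.mesh (j + 1) * |C.e| / e₁ * |A ⟨z.shift μ, ν⟩ - A ⟨z, ν⟩| ≤ 1 * e₁ ^ ((1 : ℝ) - 1) / (P.L : ℝ) ^ (j + 1) := by
    intro e₁ he₁ hte x _ μ ν
    rw [sub_self, Real.rpow_zero, mul_one]
    have h1 : P.mesh (j + 1) * |C.e| / e₁ * |A ⟨x.shift μ, ν⟩ - A ⟨x, ν⟩| ≤ P.mesh (j + 1) * |C.e| / e₁ * δ :=
      mul_le_mul_of_nonneg_left (hreg x ν μ) (by positivity)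
    refine h1.trans ?_
    rw [div_mul_eq_mul_div, div_le_div_iff₀ he₁ hLk, one_mul]
    have h2 : P.mesh (j + 1) * |C.e| * δ * (P.L : ℝ) ^ (j + 1) = P.mesh (j + 1) * ((P.L : ℝ) ^ (j + 1) * δ * |C.e|) := by ring
    rw [h2]
    calc P.mesh (j + 1) * ((P.L : ℝ) ^ (j + 1) * δ * |C.e|) ≤ 1 * e₁ := mul_le_mul hs hte (by positivity) zero_le_one
      _ = e₁ := one_mul _
  have hV'' := hV' P hPd hPL hK₀M hk1 hkK.le hN3 hs S A heV le_rfl (hreg35 heV htV)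
  have hD'' := hD' P hPd hPL hK₀M hk1 hkK.le hN3 hs S A heD le_rfl (hreg35 heD htD)
  have hH'' := hH' P hPd hPL hK₀M hk1 hkK.le hN3 hs S A heH le_rfl (hreg35 heH htH)
  clear hV' hD' hH' hreg35
  -- source bookkeeping
  have hgM : ∀ (f : VSite V → EuclideanSpace ℝ (Fin N)) (y : HiggsLattice.Site P 0), ‖extI f y‖ ≤ ‖f‖ :=
    fun f y => norm_extI_le f y
  have hgD : ∀ (f : VSite V → EuclideanSpace ℝ (Fin N)) (x : VSite V) (z : HiggsLattice.Site P 0),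
      extI f z ≠ 0 → sdistI x f ≤ (HiggsLattice.Site.tdist x.1 z : ℝ) := by
    intro f x z hz
    obtain ⟨hz', hfz⟩ := extI_ne_zero hz
    exact sdistI_le (z := ⟨z, hz'⟩) hfz
  have hrate4 : ∀ D : ℝ, Real.exp (-(D / (4 * K₀ * (P.L : ℝ) ^ (j + 1)))) = Real.exp (-(1 / (4 * K₀) * (D / (P.L : ℝ) ^ (j + 1)))) :=
    fun D => exp_rate_region (by norm_num) hK₀r.ne' hLk.ne' D
  -- the constants
  refine ⟨cV + cD + cH, 1 / (4 * K₀), by positivity, by positivity, ?_⟩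
  rintro Cc δ₀ hCc hδ₀pos hδ₀_4 D rfl
  have hCc0 : 0 ≤ Cc := by linarith only [hCc, hcV.le, hcD.le, hcH.le]
  have hcV_le : cV ≤ Cc := by linarith only [hCc, hcD.le, hcH.le]
  have hcD_le : cD ≤ Cc := by linarith only [hCc, hcV.le, hcH.le]
  have hcH_le : cH ≤ Cc := by linarith only [hCc, hcV.le, hcD.le]
  refine ⟨?_, ?_, ?_⟩
  · -- (3.7) `G_k(Ω, A)` — every point
    intro f x
    show ‖(P.mesh (j + 1) ^ 2)⁻¹ • propagatorK C (cellBox (j + 1) K₀ S) A msq a (j + 1) (chi (cellBox (j + 1) K₀ S) • extI f) x.1‖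
        ≤ Cc * Real.exp (-(δ₀ * (sdistI x f / (P.L : ℝ) ^ (j + 1)))) * ‖f‖
    have hb := hV'' x.1 (extI f) ‖f‖ (sdistI x f) (hgM f) (sdistI_nonneg x f) (fun z hz => hgD f x z hz)
    rw [hrate4] at hb
    rw [norm_smul, Real.norm_of_nonneg (inv_nonneg.2 (sq_nonneg _))]
    have hs0 : 0 ≤ sdistI x f / (P.L : ℝ) ^ (j + 1) := div_nonneg (sdistI_nonneg x f) hLk.le
    exact (inv_meshsq_mul_le_of_le' hmesh hb).trans (weight_mono_region hcV_le hCc0 hδ₀_4 hs0 (norm_nonneg _))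
  · -- (3.7) `D^η_{A,μ}G_k(Ω, A)` — every bond of `Ω`
    intro μ f x hxB
    obtain ⟨hxΩ, hxμ⟩ := mem_bset.1 hxB
    show ‖(P.mesh (j + 1))⁻¹ • covDeriv C A (propagatorK C (cellBox (j + 1) K₀ S) A msq a (j + 1) (chi (cellBox (j + 1) K₀ S) • extI f)) ⟨x.1, μ⟩‖
        ≤ Cc * Real.exp (-(δ₀ * (sdistI x f / (P.L : ℝ) ^ (j + 1)))) * ‖f‖
    have hb := hD'' x.1 μ hxΩ (hxμ μ) (extI f) ‖f‖ (sdistI x f) (hgM f) (sdistI_nonneg x f) (fun z hz => hgD f x z hz)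
    rw [hrate4] at hb
    rw [norm_smul, Real.norm_of_nonneg (inv_nonneg.2 hmesh.le)]
    have hs0 : 0 ≤ sdistI x f / (P.L : ℝ) ^ (j + 1) := div_nonneg (sdistI_nonneg x f) hLk.le
    exact (inv_mesh_mul_le_of_le' hmesh hb).trans (weight_mono_region hcD_le hCc0 hδ₀_4 hs0 (norm_nonneg _))
  · -- (3.8) — every pair of bonds of `Ω` joined by a staircase inside `Ω`
    intro μ f x y hxy hxB hyB hconv
    obtain ⟨hxΩ, hxμ⟩ := mem_bset.1 hxB
    obtain ⟨hyΩ, hyμ⟩ := mem_bset.1 hyB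
    have hxy' : x.1 ≠ y.1 := fun h => hxy (Subtype.ext h)
    show ((HiggsLattice.Site.tdist x.1 y.1 : ℝ) / (P.L : ℝ) ^ (j + 1)) ^ (-(1 / 2 : ℝ)) *
          ‖hol C A y.1 (Γ y.1 x.1) ((P.mesh (j + 1))⁻¹ • covDeriv C A
              (propagatorK C (cellBox (j + 1) K₀ S) A msq a (j + 1) (chi (cellBox (j + 1) K₀ S) • extI f)) ⟨x.1, μ⟩)
            - (P.mesh (j + 1))⁻¹ • covDeriv C A (propagatorK C (cellBox (j + 1) K₀ S) A msq a (j + 1) (chi (cellBox (j + 1) K₀ S) • extI f)) ⟨y.1, μ⟩‖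
        ≤ Cc * Real.exp (-(δ₀ * (min (sdistI x f) (sdistI y f) / (P.L : ℝ) ^ (j + 1)))) * ‖f‖
    obtain ⟨hch, hend, hlen⟩ := hΓ y.1 x.1
    have hb := hH'' μ y.1 x.1 hxy' hyΩ (hyμ μ) hxΩ (hxμ μ) (Γ y.1 x.1) hch hend hconv hlen (extI f) ‖f‖
      (min (sdistI x f) (sdistI y f)) (hgM f) (le_min (sdistI_nonneg x f) (sdistI_nonneg y f))
      (fun z hz => (min_le_right _ _).trans (hgD f y z hz))
      (fun z hz => (min_le_left _ _).trans (hgD f x z hz))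
    rw [hrate4] at hb
    rw [clm_smul_sub, norm_smul, Real.norm_of_nonneg (inv_nonneg.2 hmesh.le)]
    have htpos : 0 < (HiggsLattice.Site.tdist x.1 y.1 : ℝ) / (P.L : ℝ) ^ (j + 1) := by
      have h1 : (1 : ℝ) ≤ (HiggsLattice.Site.tdist x.1 y.1 : ℝ) := by
        exact_mod_cast one_le_tdist_of_ne' (P := P) (x := x.1) (x' := y.1) (Ne.symm hxy')
      positivity
    have hpow : ((HiggsLattice.Site.tdist x.1 y.1 : ℝ) / (P.L : ℝ) ^ (j + 1)) ^ (-(1 / 2 : ℝ))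
        = (((HiggsLattice.Site.tdist y.1 x.1 : ℝ) / (P.L : ℝ) ^ (j + 1))⁻¹) ^ (1 / 2 : ℝ) := by
      rw [tdist_comm y.1 x.1, Real.rpow_neg htpos.le, Real.inv_rpow htpos.le]
    rw [hpow, mul_left_comm ((((HiggsLattice.Site.tdist y.1 x.1 : ℝ) / (P.L : ℝ) ^ (j + 1))⁻¹) ^ (1 / 2 : ℝ)) ((P.mesh (j + 1))⁻¹)]
    have hs0 : 0 ≤ min (sdistI x f) (sdistI y f) / (P.L : ℝ) ^ (j + 1) :=
      div_nonneg (le_min (sdistI_nonneg x f) (sdistI_nonneg y f)) hLk.le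
    exact (inv_mesh_mul_le_of_le' hmesh hb).trans (weight_mono_region hcH_le hCc0 hδ₀_4 hs0 (norm_nonneg _))

end Summit.QuantumFields.YangMills.BalabanUVNodes.N15KingModelRung.Curved

end
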